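import Summits.SmoothPoincare4.SmoothPoincare4.Theses.InformationMetricHadamard
import Literature.Geometry.Riemannian.HadamardExpCovering
import Literature.Topology.CoveringSpaces.CoveringSubsingletonFiber

/-!
# Stub `stub_locallyConvexCoreForcesHadamard` of line `Sketch`
# (crux `InformationMetricHadamard.AhHadamardFilling`): the core reduction

Given the two registered convexity stubs A1 (Tietze–Nakajima–Karcher in a Cartan–Hadamard
5-manifold) and A2 (item 6016 strengthened: convex bodies in a Cartan–Hadamard 5-manifold have
spherical boundary) as hypotheses `hA1`, `hA2`, we PROVE: a complete connected Riemannian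
5-manifold `(W, G)` with `sec ≤ 0` containing a closed, `δ`-locally `d`-convex set `K` with nonempty
interior onto which `W` deformation retracts, and whose frontier is an injectively immersed simply
connected closed 4-manifold `T`, is simply connected, and `T ≅ S⁴`.

Proof (S. Alexander, PAMS 64 (1977) 321–325, doi:10.2307/2041451, made synthetic): lift to the
universal Riemannian covering `F = exp_p : (ℝ⁵, F^*G) → (W, G)`, `p ∈ int K`, which is
Cartan–Hadamard in the same hypothesis format (`Literature.Geometry.Riemannian.HadamardExpCovering`);
`C = F⁻¹(K)` is closed, connected (`isPathConnected_preimage_of_isCoveringMap` with the retraction),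
locally `d̃`-convex (`locallyConvex_preimage_comap`), hence `d̃`-convex by A1; one sheet `s(T)` over
`ι(T) = ∂K` (`exists_lift_isOpen_range`) is a compact relatively open piece of `∂C = F⁻¹(∂K)`, so by
A2 `∂C = s(T)` and `T ≅ S⁴`; then the fibre of `F` over a point of `∂K` is a single point and
`W ≃ₜ ℝ⁵` is simply connected (`simplyConnectedSpace_of_isCoveringMap_of_subsingleton_fiber`).
Everything is proved (kind = proof); no definitions.
-/

noncomputable section

-- the prescribed namespace `Summit.<P>.<Sub>.…` duplicates `SmoothPoincare4` (P = Sub)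
set_option linter.dupNamespace false

open scoped Manifold ContDiff Topology
open Set Function

namespace Summit.SmoothPoincare4.SmoothPoincare4.Cruxes.AhHadamardFilling.Sketch

open Literature.Geometry.Lorentzian (PseudoRiemannianMetric IsGeodesicallyComplete)
open Literature.Geometry.Lorentzian.PseudoRiemannianMetric
open Literature.Geometry.Riemannian Literature.Geometry.Riemannian.HadamardExpCovering
open Literature.Topology.CoveringSpaces

set_option maxHeartbeats 800000 in
-- the statement alone (two nested polymorphic hypotheses) and the 150-line proof exceed the default
/-- **The registered stub `stub_locallyConvexCoreForcesHadamard` (core reduction of K1).** Given A1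
and A2 (hypotheses `hA1`, `hA2`): a complete connected Riemannian 5-manifold `(W, G)` with
`sec ≤ 0` containing a closed `δ`-locally `d`-convex set `K` with nonempty interior, onto which `W`
deformation retracts (`Hr`), and whose frontier is the image of an injective immersion `ι` of a
nonempty compact simply connected 4-manifold `T`, is simply connected, and `T ≅ S⁴`. See the
module docstring for the proof. [folklore] -/
theorem stub_locallyConvexCoreForcesHadamard
    (hA1 : ∀ (X : Type) [TopologicalSpace X] [T2Space X] [SecondCountableTopology X]
      [ChartedSpace (EuclideanSpace ℝ (Fin 5)) X] [IsManifold (𝓡 5) ∞ X] [SimplyConnectedSpace X]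
      (G : PseudoRiemannianMetric (𝓡 5) ∞ (EuclideanSpace ℝ (Fin 5)) (TangentSpace (𝓡 5) : X → Type _))
      (hG : G.IsRiemannian),
      (∀ (x : X) (r : NNReal), IsCompact {y : X | G.edist hG x y ≤ r}) →
      (∀ cov, G.IsLeviCivita cov →
        ∀ (x : X) (U V : TangentSpace (𝓡 5) x), G.sectionalCurvature cov x U V ≤ 0) →
      ∀ (C : Set X), IsClosed C → IsConnected C →
      (∀ p ∈ C, ∃ δ : ℝ, 0 < δ ∧ ∀ q ∈ C, ∀ q' ∈ C,
        G.edist hG p q < ENNReal.ofReal δ → G.edist hG p q' < ENNReal.ofReal δ →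
        ∀ m : X, G.edist hG q m + G.edist hG m q' = G.edist hG q q' → m ∈ C) →
      ∀ p ∈ C, ∀ q ∈ C, ∀ m : X, G.edist hG p m + G.edist hG m q = G.edist hG p q → m ∈ C)
    (hA2 : ∀ (X : Type) [TopologicalSpace X] [T2Space X] [SecondCountableTopology X]
      [ChartedSpace (EuclideanSpace ℝ (Fin 5)) X] [IsManifold (𝓡 5) ∞ X] [SimplyConnectedSpace X]
      (G : PseudoRiemannianMetric (𝓡 5) ∞ (EuclideanSpace ℝ (Fin 5)) (TangentSpace (𝓡 5) : X → Type _))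
      (hG : G.IsRiemannian),
      (∀ (x : X) (r : NNReal), IsCompact {y : X | G.edist hG x y ≤ r}) →
      (∀ cov, G.IsLeviCivita cov →
        ∀ (x : X) (U V : TangentSpace (𝓡 5) x), G.sectionalCurvature cov x U V ≤ 0) →
      ∀ (C : Set X), IsClosed C → (interior C).Nonempty →
      (∀ p ∈ C, ∀ q ∈ C, ∀ m : X, G.edist hG p m + G.edist hG m q = G.edist hG p q → m ∈ C) →
      ∀ (N : Type) [TopologicalSpace N] [T2Space N] [SecondCountableTopology N] [CompactSpace N]
        [Nonempty N] [ChartedSpace (EuclideanSpace ℝ (Fin 4)) N] [IsManifold (𝓡 4) ∞ N] (j : N → X),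
      ContMDiff (𝓡 4) (𝓡 5) ∞ j → Injective j →
      (∀ x : N, Injective (mfderiv (𝓡 4) (𝓡 5) j x)) → range j ⊆ frontier C →
      IsOpen (((↑) : frontier C → X) ⁻¹' range j) →
      IsCompact C ∧ range j = frontier C ∧ Nonempty (N ≃ₘ⟮𝓡 4, 𝓡 4⟯ (Metric.sphere (0 : EuclideanSpace ℝ (Fin 5)) 1)))
    (W : Type) [TopologicalSpace W] [T2Space W] [SecondCountableTopology W]
    [ChartedSpace (EuclideanSpace ℝ (Fin 5)) W] [IsManifold (𝓡 5) ∞ W] [ConnectedSpace W]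
    (G : PseudoRiemannianMetric (𝓡 5) ∞ (EuclideanSpace ℝ (Fin 5)) (TangentSpace (𝓡 5) : W → Type _))
    (hG : G.IsRiemannian)
    (hcpt : ∀ (x : W) (r : NNReal), IsCompact {y : W | G.edist hG x y ≤ r})
    (hsec : ∀ cov, G.IsLeviCivita cov →
      ∀ (x : W) (X Y : TangentSpace (𝓡 5) x), G.sectionalCurvature cov x X Y ≤ 0)
    (K : Set W) (hKc : IsClosed K) (hKint : (interior K).Nonempty) {δ : ℝ} (hδ : 0 < δ)
    (hKconv : ∀ p ∈ K, ∀ q ∈ K, G.edist hG p q < ENNReal.ofReal δ →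
      ∀ m : W, G.edist hG p m + G.edist hG m q = G.edist hG p q → m ∈ K)
    (Hr : C(unitInterval × W, W)) (hH0 : ∀ y, Hr (0, y) = y) (hH1 : ∀ y, Hr (1, y) ∈ K)
    (hHK : ∀ (s : unitInterval), ∀ a ∈ K, Hr (s, a) = a)
    (T : Type) [TopologicalSpace T] [T2Space T] [SecondCountableTopology T] [CompactSpace T]
    [Nonempty T] [ChartedSpace (EuclideanSpace ℝ (Fin 4)) T] [IsManifold (𝓡 4) ∞ T] [SimplyConnectedSpace T]
    (ι : T → W) (hιs : ContMDiff (𝓡 4) (𝓡 5) ∞ ι) (hιinj : Injective ι)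
    (hιimm : ∀ x, Injective (mfderiv (𝓡 4) (𝓡 5) ι x)) (hιK : range ι = frontier K) :
    SimplyConnectedSpace W ∧ Nonempty (T ≃ₘ⟮𝓡 4, 𝓡 4⟯ (Metric.sphere (0 : EuclideanSpace ℝ (Fin 5)) 1)) := by
  -- instances
  haveI : LocallyCompactSpace W := Manifold.locallyCompact_of_finiteDimensional (I := 𝓡 5)
  haveI : LocallyPathConnectedSpace W := ChartedSpace.locallyPathConnectedSpace (EuclideanSpace ℝ (Fin 5)) W
  haveI : PathConnectedSpace W := pathConnectedSpace_iff_connectedSpace.2 inferInstance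
  haveI hLC : G.HasLeviCivita := G.hasLeviCivita
  have hk1 : ((1 : ℕ∞) : ℕ∞ω) + 1 ≤ (∞ : ℕ∞ω) := by
    rw [show ((1 : ℕ∞) : ℕ∞ω) + 1 = 2 by norm_num]
    exact WithTop.coe_le_coe.2 le_top
  haveI : CovariantDerivative.ContMDiffCovariantDerivative G.leviCivita 1 :=
    ⟨G.isLocallyContMDiff_leviCivita_holds 1 hk1 univ isOpen_univ⟩
  haveI : LocallyPathConnectedSpace T := ChartedSpace.locallyPathConnectedSpace (EuclideanSpace ℝ (Fin 4)) T
  -- (1) the universal covering `F = exp_p`, `p` an interior point of `K`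
  obtain ⟨p, hp⟩ := hKint
  obtain ⟨hF, hinj, hsurj, hcov⟩ := expMap_immersion_covering G hG hcpt hsec p
  set F : (EuclideanSpace ℝ (Fin 5)) → W := fun u : (EuclideanSpace ℝ (Fin 5)) ↦ expMap G.leviCivita p (show TangentSpace (𝓡 5) p from u)
    with hFdef
  have hF0 : F 0 = p := expMap_zero (cov := G.leviCivita) p
  have hFo : IsOpenMap F := hcov.isOpenMap
  have hFc : Continuous F := hcov.continuous
  -- (2) the lifted metric is Cartan–Hadamard
  set Gt := G.comap contMDiff_pullbackBilin_holds F hF hinj rfl with hGtdef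
  have hGt : Gt.IsRiemannian := isRiemannian_comap G hF hinj hG
  have hcptT := isCompact_setOf_edist_le_comap G hF hinj hG hcpt hcov
  have hsecT := sectionalCurvature_comap_nonpos G hF hinj hsec
  -- (3) the lifted core `C = F ⁻¹' K` is closed and connected
  set C : Set (EuclideanSpace ℝ (Fin 5)) := F ⁻¹' K with hCdef
  have hCc : IsClosed C := hKc.preimage hFc
  have hKpc : IsPathConnected K := by
    have hr : range (fun y : W ↦ Hr (1, y)) = K := by
      ext a
      constructor
      · rintro ⟨y, rfl⟩
        exact hH1 y
      · intro ha
        exact ⟨a, hHK 1 a ha⟩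
    rw [← hr]
    exact isPathConnected_range (Hr.continuous.comp (Continuous.prodMk_right 1))
  have hKne : K.Nonempty := ⟨p, interior_subset hp⟩
  have hCpc : IsPathConnected C := by
    refine isPathConnected_preimage_of_isCoveringMap hcov hKpc
      (exists_path_homotopic_of_retractionHomotopy Hr hH0 hH1 hHK) ?_
    obtain ⟨a, ha⟩ := hKne
    obtain ⟨e, he⟩ := hsurj a
    refine ⟨e, ?_⟩
    show F e ∈ K
    rw [he]
    exact ha
  have hCconn : IsConnected C := hCpc.isConnected
  -- local `d̃`-convexity upstairs and (A1): `C` is `d̃`-convex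
  have hCloc : ∀ x₀ ∈ C, ∃ δ' : ℝ, 0 < δ' ∧ ∀ q ∈ C, ∀ q' ∈ C,
      Gt.edist hGt x₀ q < ENNReal.ofReal δ' → Gt.edist hGt x₀ q' < ENNReal.ofReal δ' →
      ∀ m : (EuclideanSpace ℝ (Fin 5)),
        Gt.edist hGt q m + Gt.edist hGt m q' = Gt.edist hGt q q' → m ∈ C :=
    fun x₀ _ ↦ locallyConvex_preimage_comap G hF hinj hG hδ hKconv x₀
  have hCconv : ∀ p ∈ C, ∀ q ∈ C, ∀ m : (EuclideanSpace ℝ (Fin 5)),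
      Gt.edist hGt p m + Gt.edist hGt m q = Gt.edist hGt p q → m ∈ C :=
    hA1 (EuclideanSpace ℝ (Fin 5)) Gt hGt hcptT hsecT C hCc hCconn hCloc
  -- (4) an interior point upstairs
  have hCint : (interior C).Nonempty := by
    refine ⟨0, ?_⟩
    have h1 : (0 : (EuclideanSpace ℝ (Fin 5))) ∈ F ⁻¹' interior K := by
      show F 0 ∈ interior K
      rw [hF0]
      exact hp
    exact preimage_interior_subset_interior_preimage hFc h1
  -- (5) the sheet over `ι(T) = frontier K` through a point over `ι σ₀`
  obtain ⟨σ₀⟩ := ‹Nonempty T›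
  obtain ⟨e₀, he₀⟩ := hsurj (ι σ₀)
  have hιemb : Topology.IsEmbedding ι := (hιs.continuous.isClosedEmbedding hιinj).isEmbedding
  obtain ⟨s, hsF, -, hsopen⟩ := exists_lift_isOpen_range hcov hιemb (t₀ := σ₀) (e := e₀) he₀
  have hsF' : ∀ σ, F (s σ) = ι σ := fun σ ↦ congr_fun hsF σ
  -- smoothness, injectivity and immersivity of the sheet
  have hloc : IsLocalDiffeomorph 𝓘(ℝ, EuclideanSpace ℝ (Fin 5)) (𝓡 5) ∞ F :=
    RiemannianCovering.isLocalDiffeomorph_of_injective_mfderiv hF hinj rfl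
  have hss : ContMDiff (𝓡 4) 𝓘(ℝ, EuclideanSpace ℝ (Fin 5)) ∞ s := fun σ ↦
    RiemannianCovering.contMDiffAt_of_comp_isLocalDiffeomorphAt (hloc (s σ))
      s.continuous.continuousAt (by rw [hsF]; exact hιs σ)
  have hsinj : Injective s := fun a b hab ↦ hιinj (by rw [← hsF' a, ← hsF' b, hab])
  have hsimm : ∀ σ, Injective (mfderiv (𝓡 4) 𝓘(ℝ, EuclideanSpace ℝ (Fin 5)) s σ) := by
    intro σ
    have hFd : MDifferentiableAt 𝓘(ℝ, EuclideanSpace ℝ (Fin 5)) (𝓡 5) F (s σ) :=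
      ((hF.of_le le_self_add) (s σ)).mdifferentiableAt (by simp)
    have hsd : MDifferentiableAt (𝓡 4) 𝓘(ℝ, EuclideanSpace ℝ (Fin 5)) s σ :=
      (hss σ).mdifferentiableAt (by simp)
    have hchain : mfderiv (𝓡 4) (𝓡 5) ι σ =
        (mfderiv 𝓘(ℝ, EuclideanSpace ℝ (Fin 5)) (𝓡 5) F (s σ)).comp
          (mfderiv (𝓡 4) 𝓘(ℝ, EuclideanSpace ℝ (Fin 5)) s σ) := by
      rw [← hsF]
      exact mfderiv_comp σ hFd hsd
    have key : ∀ u, mfderiv (𝓡 4) (𝓡 5) ι σ u =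
        mfderiv 𝓘(ℝ, EuclideanSpace ℝ (Fin 5)) (𝓡 5) F (s σ)
          (mfderiv (𝓡 4) 𝓘(ℝ, EuclideanSpace ℝ (Fin 5)) s σ u) := fun u ↦ by
      rw [hchain]
      rfl
    intro v w hvw
    apply hιimm σ
    rw [key, key, hvw]
  -- (6) the sheet is a relatively open piece of `frontier C = F ⁻¹' (frontier K)`
  have hfrC : frontier C = F ⁻¹' range ι := by
    rw [hιK]
    exact (hFo.preimage_frontier_eq_frontier_preimage hFc K).symm
  have hrange : range s ⊆ frontier C := by
    rw [hfrC]
    rintro _ ⟨σ, rfl⟩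
    exact ⟨σ, (hsF' σ).symm⟩
  have hopen' : IsOpen (((↑) : frontier C → (EuclideanSpace ℝ (Fin 5))) ⁻¹' range s) := by
    obtain ⟨O, hO, hOeq⟩ := isOpen_induced_iff.1 hsopen
    refine isOpen_induced_iff.2 ⟨O, hO, ?_⟩
    ext ⟨w, hw⟩
    have hw' : w ∈ F ⁻¹' range ι := by
      rw [← hfrC]
      exact hw
    have h := congrArg (fun A : Set (F ⁻¹' range ι) ↦ (⟨w, hw'⟩ : F ⁻¹' range ι) ∈ A) hOeq
    simp only [mem_preimage, eq_iff_iff] at h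
    exact h
  -- (7) the convex-body boundary theorem (A2)
  obtain ⟨-, hfr, hdiff⟩ :=
    hA2 (EuclideanSpace ℝ (Fin 5)) Gt hGt hcptT hsecT C hCc hCint hCconv T s hss hsinj hsimm hrange
      hopen'
  refine ⟨?_, hdiff⟩
  -- (8) the fibre of `F` over `ι σ₀` is a single point, so `W ≃ₜ ℝ⁵` is simply connected
  have hsub : (F ⁻¹' {ι σ₀}).Subsingleton := by
    have hmem : ∀ e, F e = ι σ₀ → e ∈ range s := fun e he ↦ by
      rw [hfr, hfrC]
      exact ⟨σ₀, he.symm⟩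
    intro e₁ he₁ e₂ he₂
    obtain ⟨σ₁, rfl⟩ := hmem e₁ he₁
    obtain ⟨σ₂, rfl⟩ := hmem e₂ he₂
    have h1 : ι σ₁ = ι σ₂ := by
      rw [← hsF' σ₁, ← hsF' σ₂]
      exact (mem_singleton_iff.1 he₁).trans (mem_singleton_iff.1 he₂).symm
    rw [hιinj h1]
  exact simplyConnectedSpace_of_isCoveringMap_of_subsingleton_fiber hcov hsurj hsub

end Summit.SmoothPoincare4.SmoothPoincare4.Cruxes.AhHadamardFilling.Sketch

end
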